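import Summits.AtomisticToContinuum.HydrodynamicLimit.Theorems.RelayRaceLocalityNearConstantShortTimeHLAssemblyTheta
import Summits.AtomisticToContinuum.HydrodynamicLimit.Theorems.RelayRaceLocalityNearConstantShortTimeHLMeansPinEntropy
import Summits.AtomisticToContinuum.HydrodynamicLimit.Theorems.DenseExcursion.Negative.Everywhere
import HarnessLib

/-!
# Crux `NearConstantShortTimeHL` (stmt-AtomisticToContinuum-12502), line `small-tilt-domination` — stub `isentropy_bookkeeping`

Support file (`--supports stmt-AtomisticToContinuum-12502`, route `route-AtomisticToContinuum-RelayRaceLocality`) proving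
the registered stub `isentropy_bookkeeping` (iii) of the line `small-tilt-domination` (skeleton
`Cruxes/NearConstantShortTimeHL/Lines/small_tilt_domination.lean`), a helper of the Grönwall assembly
`stub_gronwallAssembly` of Yau's relative-entropy method for hard spheres.

THE STATICS BOOKKEEPING: along a classical hard-sphere Euler solution `(ρ, u, θ)` on `[0, T)` whose past `[0, t]` stays
in the packing band `ρσ³ < η₀` (where `f_ex = hsExcessFreeEnergy` agrees with an analytic germ `F` on `[0, η₀)`), the
difference "static mean of the log-profile minus pressure",

  `m^{st}(r) − π(r)`,  `m^{st}(r) = ∫ ρ_r (log ρ_r + g_σ(ρ_r) − 3/2 log(2πθ_r) − 3/2)`,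
  `π(r) = ∫ ρ_r · ρ_r σ³ f_ex′(ρ_r σ³)`,

is the same at `r = 0` and at every `r ∈ [0, t]`.  Indeed, with `g_σ(a) − aσ³ f_ex′(aσ³) = f_ex(aσ³)` (`gChem`) and
`log(2πθ) = log 2π + log θ`, it splits as `−S(r) − (3/2 log 2π + 3/2) ∫ ρ_r` with the thermodynamic entropy
`S(r) = ∫ ρ_r (3/2 log θ_r − log ρ_r − f_ex(ρ_r σ³))` (`xj_integral_split`), conserved for classical (shock-free)
solutions in the band (isentropy, `integral_entropy_eq_of_band_Icc`), while `∫ ρ_r = ∫ ρ_0` is mass conservation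
(`DenseExcursionEverywhere.integral_density_eq`).  This is Step 4 of the landed `stub_meansPin`, between `0` and an
arbitrary `r ∈ [0, t]`.

References: H.-T. Yau, Lett. Math. Phys. 22 (1991) §2; S. Olla – S.R.S. Varadhan – H.-T. Yau, Comm. Math. Phys. 155
(1993) §3.  No definitions.
-/

noncomputable section

namespace Summit.AtomisticToContinuum.HydrodynamicLimit.Theorems.NearConstantShortTimeHL

open scoped BigOperators ENNReal Topology
open MeasureTheory Set Filter
open Literature.MathematicalPhysics.KineticTheory Literature.Analysis.FluidPDE Literature.Analysis.FunctionSpaces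

/-- **Splitting of `m^{st} − π` at one time.** For a classical hard-sphere Euler solution at a time `s ∈ [0, T)` in the
band `ρ_s σ³ < η₀`, with `f_ex` smooth on `(0, η₀)`:
`∫ ρ_s (log ρ_s + g_σ(ρ_s) − 3/2 log(2πθ_s) − 3/2) − ∫ ρ_s ρ_s σ³ f_ex′(ρ_s σ³)
  = −∫ ρ_s (3/2 log θ_s − log ρ_s − f_ex(ρ_s σ³)) − (3/2 log 2π + 3/2) ∫ ρ_s`
(pointwise `g_σ(a) − aσ³ f_ex′(aσ³) = f_ex(aσ³)` and `log(2πθ) = log 2π + log θ`; all integrands are continuous on the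
compact torus). [cite: Yau1991, §2] -/
theorem xj_integral_split {η₀ σ T : ℝ} (hσ : 0 < σ)
    (hfex : ContDiffOn ℝ ((⊤ : ℕ∞) : WithTop ℕ∞) hsExcessFreeEnergy (Ioo 0 η₀))
    {ρ θ : ℝ → T3 → ℝ} {u : ℝ → T3 → V3} (hE : IsHardSphereEulerSolution σ T ρ u θ)
    {s : ℝ} (hs : s ∈ Ico 0 T) (hbs : ∀ x, ρ s x * σ ^ 3 < η₀) :
    (∫ x, ρ s x * (Real.log (ρ s x) + gChem σ (ρ s x) - 3 / 2 * Real.log (2 * Real.pi * θ s x) - 3 / 2)) -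
        (∫ x, ρ s x * (ρ s x * σ ^ 3 * deriv hsExcessFreeEnergy (ρ s x * σ ^ 3))) =
      -(∫ x, ρ s x * (3 / 2 * Real.log (θ s x) - Real.log (ρ s x) - hsExcessFreeEnergy (ρ s x * σ ^ 3))) -
        (3 / 2 * Real.log (2 * Real.pi) + 3 / 2) * ∫ x, ρ s x := by
  have hσ3 : 0 < σ ^ 3 := pow_pos hσ 3
  have hρc : Continuous (ρ s) := (hE.smooth_density.isSmooth_slice hs).continuous
  have hθc : Continuous (θ s) := (hE.smooth_temperature.isSmooth_slice hs).continuous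
  have hρp : ∀ x, 0 < ρ s x := hE.density_pos s hs
  have hθp : ∀ x, 0 < θ s x := hE.temperature_pos s hs
  have hbs' : ∀ x, ρ s x * σ ^ 3 ∈ Ioo 0 η₀ := fun x => ⟨mul_pos (hρp x) hσ3, hbs x⟩
  have hηc : Continuous fun x => ρ s x * σ ^ 3 := hρc.mul continuous_const
  have hfc : Continuous fun x => hsExcessFreeEnergy (ρ s x * σ ^ 3) :=
    hfex.continuousOn.comp_continuous hηc hbs'
  have hf'c : Continuous fun x => deriv hsExcessFreeEnergy (ρ s x * σ ^ 3) :=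
    (hfex.continuousOn_deriv_of_isOpen isOpen_Ioo (by simp)).comp_continuous hηc hbs'
  have hgc : Continuous fun x => gChem σ (ρ s x) := hfc.add (hηc.mul hf'c)
  have hlogρ : Continuous fun x => Real.log (ρ s x) := hρc.log fun x => (hρp x).ne'
  have hlogθ : Continuous fun x => Real.log (θ s x) := hθc.log fun x => (hθp x).ne'
  have hlog2θ : Continuous fun x => Real.log (2 * Real.pi * θ s x) :=
    (continuous_const.mul hθc).log fun x => (mul_pos (mul_pos two_pos Real.pi_pos) (hθp x)).ne'
  have hi1 : Integrable (fun x => ρ s x * (Real.log (ρ s x) + gChem σ (ρ s x) -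
      3 / 2 * Real.log (2 * Real.pi * θ s x) - 3 / 2)) :=
    integrable_of_continuous_T3
      (hρc.mul (((hlogρ.add hgc).sub (continuous_const.mul hlog2θ)).sub continuous_const))
  have hi2 : Integrable (fun x => ρ s x * (ρ s x * σ ^ 3 * deriv hsExcessFreeEnergy (ρ s x * σ ^ 3))) :=
    integrable_of_continuous_T3 (hρc.mul (hηc.mul hf'c))
  have hi3 : Integrable (fun x => ρ s x * (3 / 2 * Real.log (θ s x) - Real.log (ρ s x) -
      hsExcessFreeEnergy (ρ s x * σ ^ 3))) :=
    integrable_of_continuous_T3 (hρc.mul (((continuous_const.mul hlogθ).sub hlogρ).sub hfc))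
  have hi4 : Integrable (ρ s) := integrable_of_continuous_T3 hρc
  have hpt : (fun x => ρ s x * (Real.log (ρ s x) + gChem σ (ρ s x) - 3 / 2 * Real.log (2 * Real.pi * θ s x) -
      3 / 2) - ρ s x * (ρ s x * σ ^ 3 * deriv hsExcessFreeEnergy (ρ s x * σ ^ 3))) =
      fun x => -(ρ s x * (3 / 2 * Real.log (θ s x) - Real.log (ρ s x) - hsExcessFreeEnergy (ρ s x * σ ^ 3))) -
        (3 / 2 * Real.log (2 * Real.pi) + 3 / 2) * ρ s x := by
    funext x
    have hl : Real.log (2 * Real.pi * θ s x) = Real.log (2 * Real.pi) + Real.log (θ s x) :=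
      Real.log_mul (mul_pos two_pos Real.pi_pos).ne' (hθp x).ne'
    simp only [gChem, hl]
    ring
  rw [← integral_sub hi1 hi2, hpt, integral_sub hi3.fun_neg (hi4.const_mul _), integral_neg, integral_const_mul]

/-- **(iii) The bookkeeping identity `m^{st}(0) − π(0) = m^{st}(r) − π(r)`** (registered stub `isentropy_bookkeeping`
of line `small-tilt-domination`). Along a classical hard-sphere Euler solution on `[0, T)` whose past `[0, t]`
(`t < T`) stays in the packing band `ρσ³ < η₀`, `f_ex` agreeing on `[0, η₀)` with a germ `F` analytic on `(−η₀, η₀)`,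
the static mean of the log-profile minus the pressure,
`∫ ρ_r (log ρ_r + g_σ(ρ_r) − 3/2 log(2πθ_r) − 3/2) − ∫ ρ_r ρ_r σ³ f_ex′(ρ_r σ³)`, takes the same value at `0` and at
every `r ∈ [0, t]`: by `xj_integral_split` it is `−S(r) − (3/2 log 2π + 3/2) ∫ ρ_r`, the thermodynamic entropy `S` is
conserved for classical solutions in the band (isentropy, `integral_entropy_eq_of_band_Icc`) and `∫ ρ_r = ∫ ρ_0`
(mass conservation, `DenseExcursionEverywhere.integral_density_eq`). [cite: Yau1991, §2] -/
theorem isentropy_bookkeeping : ∀ {η₀ : ℝ} {F : ℝ → ℝ}, 0 < η₀ → AnalyticOnNhd ℝ F (Set.Ioo (-η₀) η₀) → Set.EqOn hsExcessFreeEnergy F (Set.Ico 0 η₀) → ∀ {σ T : ℝ}, 0 < σ → ∀ {ρ θ : ℝ → T3 → ℝ} {u : ℝ → T3 → V3}, IsHardSphereEulerSolution σ T ρ u θ → ∀ {t : ℝ}, t ∈ Set.Ico 0 T → (∀ s ∈ Set.Icc 0 t, ∀ x, ρ s x * σ ^ 3 < η₀) → ∀ r ∈ Set.Icc 0 t, (∫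 x, ρ 0 x * (Real.log (ρ 0 x) + gChem σ (ρ 0 x) - 3 / 2 * Real.log (2 * Real.pi * θ 0 x) - 3 / 2)) - (∫ x, ρ 0 x * (ρ 0 x * σ ^ 3 * deriv hsExcessFreeEnergy (ρ 0 x * σ ^ 3))) = (∫ x, ρ r x * (Real.log (ρ r x) + gChem σ (ρ r x) - 3 / 2 * Real.log (2 * Real.pi * θ r x) - 3 / 2)) - (∫ x, ρ r x * (ρ r x * σ ^ 3 * deriv hsExcessFreeEnergy (ρ r x * σ ^ 3))) := by
  intro η₀ F hη₀ hFa hEqF σ T hσ ρ θ u hE t ht hband r hr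
  -- the excess free energy is smooth on the open band `(0, η₀)`
  have hfex : ContDiffOn ℝ ((⊤ : ℕ∞) : WithTop ℕ∞) hsExcessFreeEnergy (Ioo 0 η₀) :=
    (hFa.contDiffOn_of_completeSpace.mono (Ioo_subset_Ioo (by linarith) le_rfl)).congr
      fun a ha => hEqF ⟨ha.1.le, ha.2⟩
  -- `r ∈ [0, T)`, and the band on `[0, r] ⊆ [0, t]`
  have hrI : r ∈ Ico 0 T := ⟨hr.1, hr.2.trans_lt ht.2⟩
  have h0I : (0 : ℝ) ∈ Ico 0 T := ⟨le_rfl, hr.1.trans_lt hrI.2⟩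
  have hbandr : ∀ s ∈ Icc 0 r, ∀ x, ρ s x * σ ^ 3 < η₀ := fun s hs x =>
    hband s ⟨hs.1, hs.2.trans hr.2⟩ x
  have hb0 : ∀ x, ρ 0 x * σ ^ 3 < η₀ := fun x => hband 0 ⟨le_rfl, ht.1⟩ x
  have hbr : ∀ x, ρ r x * σ ^ 3 < η₀ := fun x => hband r hr x
  -- isentropy on `[0, r]` and mass conservation
  have hEnt := integral_entropy_eq_of_band_Icc hσ hfex hE hrI hbandr
  have hMass := DenseExcursionEverywhere.integral_density_eq hE hrI
  rw [xj_integral_split hσ hfex hE h0I hb0, xj_integral_split hσ hfex hE hrI hbr, hEnt, hMass]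

end Summit.AtomisticToContinuum.HydrodynamicLimit.Theorems.NearConstantShortTimeHL

end
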